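import Summits.QuantumFields.YangMills.Theorems.LuscherReductionTwistedTraceScalingRecordExposed
import Summits.QuantumFields.YangMills.Theorems.LuscherReductionTwistedTraceScalingValleyGainRecord
import Summits.QuantumFields.YangMills.Theorems.LuscherReductionTwistedTraceScalingOnionRefinedScales
import Summits.QuantumFields.YangMills.Theorems.LuscherReductionTwistedTraceScalingBOStiffSlowTop
import HarnessLib

/-!
# The TOP transfer value of a fixed lattice is the record's slow factor times the one-site top value: `λ₀(β, L) ≤ e^{ελ_b(L³β)}·recordSigma L β·μ₀(L³β)`
# eventually in `β`, every `ε > 0`, every `L ≥ 2` — with the record floor ✓`record_floor` (`e^{−λ_b}·recordSigma·μ₀ ≤ λ₀`) the two-sided asymptotics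
# `λ₀(β, L) = e^{o(λ_b)}·recordSigma L β·μ₀(L³β)`; first half of BO_lower(L) ∕ COARSE-LOWER(L)
# (lane A of S-BASE, crux `TwistedTraceScaling` stmt-QuantumFields-20203, line «twolattice», stub `stub_fixedLatticeTraceLaw`; lead g23; `HANDOFF-g23.md`)

COARSE-LOWER(L) (hypothesis `hLow` of ✓`Base.fixedLatticeTraceLaw_of_coarse`) follows from the RELATIVE Born–Oppenheimer lower comparison
`BO_lower(L) : μ_k(L³β)·λ₀(β,L) ≤ e^{ελ_b}·λ_k(β,L)·μ₀(L³β)` through ✓`BOHandover.coarseLowerAt_of_boLower L` (pattern of ✓`…BaseOne.coarseLower_one`).  `BO_lower(L)` is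
(U) `λ₀ ≤ e^{ελ_b}·σ·μ₀` times (F_k) `e^{−ελ_b}·σ·μ_k ≤ λ_k` with the SAME slow factor `σ = recordSigma L β` (✓`…RecordExposed`).  This file proves (U):
* §1 `coreUpper_of_boBricks (K : BOBricks L χ δ)` — the ABSOLUTE sup bound on the soft tube: eventually every bounded measurable `f` supported in `supp χ ∩ {orbitDist < δ}` has
  `T(f) ≤ e^{ελ_b}·(K.σ·μ₀)·‖f‖²_{N/χ}` — ✓`shell_gain_fixed` with NO gain (`g = t = 0`: the one-site bound `⟨G,K_BG⟩ ≤ μ₀(B)‖G‖²` for EVERY bounded measurable `G` is Perron–Frobenius,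
  ✓`PhysL2.qform_le_levelValue_zero_mul_l2_of_bdd`), factor `1 + 6κ + 2b²/θ₀ ≤ e^{ελ_b}` by `hκ_small`, `hb_small`;
* §2 `coreUpper_oneOrbit_of_boBricks` — slice reduction (✓`qform_eq_integral_avgKernel`, ✓`l2_eq_sliceFn_left`) to gauge-invariant `G` supported in `{orbitDist < δ}`;
  `coreUpper_record (hL2 : 2 ≤ L)` — the record instance at core exponent `9/50` in `recordSigma`-currency (`A.σ = recordSigma`, ✓`recordAnalyticInput_x`);
* §3 ★★★ `lambda0_le_record (hL2 : 2 ≤ L) (hε : 0 < ε) : ∀ᶠ β, λ₀(β,L) ≤ e^{ελ_b(L³β)}·(recordSigma L β·μ₀(L³β))` — refined onion ✓`qform_le_three_regions_lat₂` at `(β^{−9/50}, β^{−17/20})`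
  (✓`scalesAdmissible₂_powScale₉`), inner piece = eight copies (✓`abs_qform_inner_sub_le`, ✓`l2_inner_eq`, ✓`crossBound_eventually_small`) of `innerCut·ψ` bounded by §2, valley piece by
  ✓`valleyGain_record` (`≤ e^{−λ_b}λ₀‖·‖²`), the `k = 0` door ✓`levelValue_zero_le_of_forall_rayleigh_le`, and the endgame `arith_lambda0`
  (`Λ ≤ max(X + cλΛ, e^{−λ}Λ) + cλΛ`, `c ≤ 1/4`, `λ ≤ 1` ⇒ `Λ ≤ e^{4cλ}X`).
HONEST FRAMING: fixed lattice size `L ≥ 2`, eventually in `β`; (F_k), BO_lower(L), COARSE-LOWER(L), W(L) ∕ COARSE-TAIL(L), `stub_cmpTwoLoop` and the crux stay OPEN; CONDITIONAL route R2b1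
(Lüscher two-lattice reduction); not infinite volume, not a mass gap, not Clay.  No named facts, no `sorry`.
-/

set_option autoImplicit false

noncomputable section

open MeasureTheory Filter Topology Real
open scoped BigOperators
open Literature.MathematicalPhysics.QuantumFieldTheory
open Literature.MathematicalPhysics.QuantumLattice

namespace Summit.QuantumFields.YangMills.Theorems.FemtoTransferGap.TwoLattice.ConstTube

open Summit.QuantumFields.YangMills.Theorems.FemtoTransferGap
open Summit.QuantumFields.YangMills.Theorems.FemtoTransferGap.TwoLattice.Avg

variable {L : ℕ} [NeZero L]

/-! ## §1 The absolute sup bound on the soft tube from the bricks -/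

set_option maxHeartbeats 400000 in
/-- ★★ **ABSOLUTE SUP BOUND ON THE SOFT TUBE**: from `BOBricks L χ δ`, for every `ε > 0`, eventually in `β`, every bounded measurable `f` supported in `supp χ ∩ {orbitDist < δ}` has
`T(f) ≤ e^{ελ_b(L³β)}·(σ·μ₀(L³β))·‖f‖²_{N/χ}` with the brick list's own `σ`.  (✓`shell_gain_fixed` at `g = t = 0`.) [cite: Luscher1983, §3] [cite: SjostrandZworski2007, §2] -/
theorem coreUpper_of_boBricks {χ : ℝ → GaugeConfig 3 L SU2 → ℝ} {δ : ℝ → ℝ} (K : BOBricks L χ δ) {ε : ℝ} (hε : 0 < ε) :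
    ∀ᶠ β : ℝ in atTop, ∀ f : GaugeConfig 3 L SU2 → ℝ, Measurable f → (∃ C : ℝ, ∀ U, |f U| ≤ C) →
      (∀ U, f U ≠ 0 → χ β U ≠ 0 ∧ orbitDist U < δ β) →
        tubeForm β f ≤ Real.exp (ε * bareLambda ((L : ℝ) ^ 3 * β)) * (K.σ β * levelValue su2Rep 1 ((L : ℝ) ^ 3 * β) 0) *
          tubeNormSq (softWeight (χ β)) f := by
  have hL1 : (1 : ℝ) ≤ (L : ℝ) ^ 3 := one_le_pow₀ (by exact_mod_cast NeZero.one_le)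
  obtain ⟨hθ0, -⟩ := K.hθ₀
  filter_upwards [Filter.eventually_ge_atTop (2 : ℝ), K.hδ₁, K.hshadow, K.hbo, K.hκ_small (ε / 12) (by positivity), K.hb_small (ε * K.θ₀ / 4) (by positivity),
    K.hκ_small (1 / 2) one_half_pos, K.hN, K.hT, K.hST, K.hOD] with β hβ hδ₁ hshadow hbo hκε hbε hκh hN hT hST hOD
  intro f hfm hfb hfs
  have hβ0 : 0 < β := by linarith only [hβ]
  have hBβ : β ≤ (L : ℝ) ^ 3 * β := by nlinarith only [hL1, hβ0]
  have hB0 : 0 < (L : ℝ) ^ 3 * β := lt_of_lt_of_le hβ0 hBβ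
  have hlam0 : 0 < bareLambda ((L : ℝ) ^ 3 * β) := bareLambda_pos' hB0
  have hlam1 : bareLambda ((L : ℝ) ^ 3 * β) ≤ 1 := bareLambda_cube_le (L := L) one_pos (by norm_num; exact hβ)
  have hμ0 : 0 < levelValue su2Rep 1 ((L : ℝ) ^ 3 * β) 0 := levelValue_su2Rep_pos (L := 1) hB0 0
  obtain ⟨Cw, hCw⟩ := K.hwb β
  obtain ⟨Cf, hCf⟩ := hfb
  have hκ0 := K.hκ β
  have hκhalf : K.κ β ≤ 1 / 2 := by linarith only [hκh, hlam1]
  -- the trivial one-site bound (`g = 0`, `t = 0`): Perron–Frobenius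
  have hAG : ∀ G : GaugeConfig 3 1 SU2 → ℝ, Measurable G → (∃ C : ℝ, ∀ u, |G u| ≤ C) →
      (∀ (g' : Site 3 1 → SU2) (u : GaugeConfig 3 1 SU2), G (gaugeTransform g' u) = G u) → (∀ u, G u ≠ 0 → 6 * (0 : ℝ) ≤ orbitDist u ∧ orbitDist u < 2) →
      qform su2Rep ((L : ℝ) ^ 3 * β) G G ≤ (1 - 0) * levelValue su2Rep 1 ((L : ℝ) ^ 3 * β) 0 * l2 G G := fun G hGm hGb _ _ => by
    obtain ⟨C, hC⟩ := hGb
    rw [sub_zero, one_mul]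
    exact PhysL2.qform_le_levelValue_zero_mul_l2_of_bdd ((L : ℝ) ^ 3 * β) hGm hC
  -- (B-T) upper half
  have hTup : ∀ φ : GaugeConfig 3 1 SU2 → ℝ, Measurable φ → (∃ C : ℝ, ∀ u, |φ u| ≤ C) →
      (∀ (g : Site 3 1 → SU2) (u : GaugeConfig 3 1 SU2), φ (gaugeTransform g u) = φ u) → (∀ u, φ u ≠ 0 → u ∈ K.𝒰 β) →
      tubeForm β (boFun L φ (K.Ω β)) ≤ K.σ β * K.γ β * (1 + K.κ β) * qform su2Rep ((L : ℝ) ^ 3 * β) φ φ +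
        K.κ β * K.σ β * K.γ β * levelValue su2Rep 1 ((L : ℝ) ^ 3 * β) 0 * l2 φ φ :=
    fun φ h1 h2 h3 h4 => by have := (abs_le.mp (hT φ h1 h2 h3 h4)).2; linarith only [this]
  -- supports of `f`
  have hfs1 : ∀ U, f U ≠ 0 → χ β U ≠ 0 := fun U h => (hfs U h).1
  have hfsh : ∀ U, f U ≠ 0 → slowMean L U ∈ K.𝒰 β := fun U h => hshadow U (hfs U h).1 (hfs U h).2
  have hφin : ∀ u, boCoeff L (softWeight (χ β)) (K.Ω β) (K.𝒰 β) f u ≠ 0 → 6 * (0 : ℝ) ≤ orbitDist u := fun u _ => by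
    rw [mul_zero]; exact orbitDist_nonneg u
  have hδ₁2 : K.δ₁ β ≤ 2 := by linarith only [hδ₁]
  have hfix := shell_gain_fixed (K.hwm β) hCw (K.hw0 β) (K.hwinv β) (K.hΩm β) (K.hΩ1 β) (K.hΩinv β) (K.h𝒰m β) (K.h𝒰inv β) (K.h𝒰δ₁ β) hδ₁2
    (K.hσ β).le (K.hγ β) hκ0 hκhalf hN hTup le_rfl zero_le_one hAG hμ0.le hθ0 hST hOD (fun φ U hφ hU => (hbo φ U hφ hU).1) hfm hCf hfs1 hfsh hφin
  -- arithmetic: `1 + 6κ + 2b²/θ₀ ≤ e^{ελ}`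
  have hb2 : 0 ≤ 2 * K.b β ^ 2 / K.θ₀ := by positivity
  have hmin : min (0 - 6 * K.κ β - 2 * K.b β ^ 2 / K.θ₀) (K.θ₀ / 2) = 0 - 6 * K.κ β - 2 * K.b β ^ 2 / K.θ₀ :=
    min_eq_left (by linarith only [hb2, hκ0, hθ0])
  have hfac : 1 - min (0 - 6 * K.κ β - 2 * K.b β ^ 2 / K.θ₀) (K.θ₀ / 2) ≤ Real.exp (ε * bareLambda ((L : ℝ) ^ 3 * β)) := by
    rw [hmin]
    have h2 : 2 * K.b β ^ 2 / K.θ₀ ≤ ε * bareLambda ((L : ℝ) ^ 3 * β) / 2 := by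
      rw [div_le_iff₀ hθ0]; nlinarith only [hbε, hθ0]
    have := Real.add_one_le_exp (ε * bareLambda ((L : ℝ) ^ 3 * β))
    linarith only [this, h2, hκε]
  have hN0 : 0 ≤ tubeNormSq (softWeight (χ β)) f := integral_nonneg fun U => mul_nonneg (sq_nonneg _) (K.hw0 β U)
  have hSg0 : 0 ≤ K.σ β * levelValue su2Rep 1 ((L : ℝ) ^ 3 * β) 0 := mul_nonneg (K.hσ β).le hμ0.le
  calc tubeForm β f ≤ K.σ β * levelValue su2Rep 1 ((L : ℝ) ^ 3 * β) 0 * (1 - min (0 - 6 * K.κ β - 2 * K.b β ^ 2 / K.θ₀) (K.θ₀ / 2)) *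
        tubeNormSq (softWeight (χ β)) f := hfix
    _ ≤ K.σ β * levelValue su2Rep 1 ((L : ℝ) ^ 3 * β) 0 * Real.exp (ε * bareLambda ((L : ℝ) ^ 3 * β)) * tubeNormSq (softWeight (χ β)) f :=
        mul_le_mul_of_nonneg_right (mul_le_mul_of_nonneg_left hfac hSg0) hN0
    _ = Real.exp (ε * bareLambda ((L : ℝ) ^ 3 * β)) * (K.σ β * levelValue su2Rep 1 ((L : ℝ) ^ 3 * β) 0) * tubeNormSq (softWeight (χ β)) f := by ring

/-! ## §2 One orbit, and the record instance -/

/-- ★★ **ABSOLUTE SUP BOUND ON ONE ORBIT**: from `BOBricks L χ δ` with `χ` admissible, for every `ε > 0`, eventually in `β`, every bounded measurable gauge-invariant `G` supported in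
`{orbitDist < δ}` has `⟨G,K_βG⟩ ≤ e^{ελ_b(L³β)}·(σ·μ₀(L³β))·‖G‖²` (slice reduction of §1). [cite: Luscher1983, §3] [cite: SeilerLNP1982, §3] -/
theorem coreUpper_oneOrbit_of_boBricks {χ : ℝ → GaugeConfig 3 L SU2 → ℝ} {δ : ℝ → ℝ} (K : BOBricks L χ δ) (hadm : SoftTubeAdmissible L δ χ) {ε : ℝ} (hε : 0 < ε) :
    ∀ᶠ β : ℝ in atTop, ∀ G : GaugeConfig 3 L SU2 → ℝ, Measurable G → (∃ C : ℝ, ∀ U, |G U| ≤ C) →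
      (∀ (g : Site 3 L → SU2) (U : GaugeConfig 3 L SU2), G (gaugeTransform g U) = G U) → (∀ U, G U ≠ 0 → orbitDist U < δ β) →
        qform su2Rep β G G ≤ Real.exp (ε * bareLambda ((L : ℝ) ^ 3 * β)) * (K.σ β * levelValue su2Rep 1 ((L : ℝ) ^ 3 * β) 0) * l2 G G := by
  obtain ⟨hχm, hχb, β1, hβ1⟩ := hadm
  filter_upwards [coreUpper_of_boBricks K hε, Filter.eventually_ge_atTop β1] with β hcore hβ G hGm hGb hGinv hGsupp
  obtain ⟨hcov, n₀, hn₀, hNlow⟩ := hβ1 β hβ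
  obtain ⟨Cχ, hCχ⟩ := hχb β
  obtain ⟨CG, hCG⟩ := hGb
  have hGcov : ∀ U, G U ≠ 0 → gaugeAvg (χ β) U ≠ 0 := fun U hU => (hcov U (hGsupp U hU)).ne'
  set f : GaugeConfig 3 L SU2 → ℝ := Avg.sliceFn (χ β) G with hf_def
  have h1 := qform_eq_integral_avgKernel β (hχm β) hCχ hn₀ hNlow hGm hCG hGinv hGcov hGm hCG hGinv hGcov
  have h2 := l2_eq_sliceFn_left (hχm β) hCχ hn₀ hNlow hGm hCG hGinv hGcov hGm hCG hGinv
  have hl2 : l2 G G = tubeNormSq (softWeight (χ β)) f := by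
    rw [h2]
    unfold l2 tubeNormSq
    refine integral_congr_ae (ae_of_all _ fun U => ?_)
    exact sliceFn_mul_self_eq (ψ := G) hn₀ hNlow U
  have hq : qform su2Rep β G G = tubeForm β f := by rw [h1]; rfl
  have hfm : Measurable f := Avg.measurable_sliceFn (hχm β) hGm
  have hfb : ∃ C : ℝ, ∀ U, |f U| ≤ C := ⟨CG * Cχ / n₀, Avg.abs_sliceFn_le hCχ hCG hn₀ hNlow⟩
  have hfs : ∀ U, f U ≠ 0 → χ β U ≠ 0 ∧ orbitDist U < δ β := fun U hU =>
    ⟨(Avg.sliceFn_ne_zero hU).1, hGsupp U (Avg.sliceFn_ne_zero hU).2⟩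
  rw [hq, hl2]
  exact hcore f hfm hfb hfs

/-- ★★ **THE RECORD INSTANCE** (`L ≥ 2`, core exponent `9/50`, `recordSigma`-currency): for every `ε > 0`, eventually in `β`, every bounded measurable gauge-invariant `G` supported in
`{orbitDist < β^{−9/50}}` has `⟨G,K_βG⟩ ≤ e^{ελ_b(L³β)}·(recordSigma L β·μ₀(L³β))·‖G‖²`. [cite: Luscher1983, §3] [cite: SjostrandZworski2007, §2] -/
theorem coreUpper_record (hL2 : 2 ≤ L) {ε : ℝ} (hε : 0 < ε) :
    ∀ᶠ β : ℝ in atTop, ∀ G : GaugeConfig 3 L SU2 → ℝ, Measurable G → (∃ C : ℝ, ∀ U, |G U| ≤ C) →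
      (∀ (g : Site 3 L → SU2) (U : GaugeConfig 3 L SU2), G (gaugeTransform g U) = G U) → (∀ U, G U ≠ 0 → orbitDist U < powScale (9 / 50) β) →
        qform su2Rep β G G ≤ Real.exp (ε * bareLambda ((L : ℝ) ^ 3 * β)) * (recordSigma L β * levelValue su2Rep 1 ((L : ℝ) ^ 3 * β) 0) * l2 G G := by
  have hLz : Nonempty (NzSite L) := nonempty_nzSite_of_two_le hL2
  have hs0 : (0 : ℝ) < 9 / 50 := by norm_num
  obtain ⟨M₀, hM₀, hrec⟩ := recordAnalyticInput_x (L := L) hLz hL2 (s := 9 / 50) (by norm_num) (by norm_num)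
  have hδ0 : ∀ β, 0 < 43 * powScale (9 / 50) β := fun β => mul_pos (by norm_num) (powScale_pos _ β)
  have hδt : Tendsto (fun β => 43 * powScale (9 / 50) β) atTop (𝓝 0) := by
    have := (tendsto_powScale hs0).const_mul 43; simpa using this
  have hsd : ∀ᶠ β in atTop, 0 < powScale 1 β ∧ powScale 1 β ≤ (43 * powScale (9 / 50) β) ^ 3 := by
    filter_upwards [Filter.eventually_ge_atTop (1 : ℝ)] with β hβ
    refine ⟨powScale_pos 1 β, (powScale_one_le_cube (σ := 9 / 50) (by norm_num) hβ).trans ?_⟩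
    have hp := powScale_pos (9 / 50) β
    have h1 : powScale (9 / 50) β ≤ 43 * powScale (9 / 50) β := by nlinarith
    exact pow_le_pow_left₀ hp.le h1 3
  obtain ⟨M₁, hM₁, hPM⟩ := fpWeight_core_constant L hLz hδ0 hδt hsd
  obtain ⟨A, -, -, hAσ⟩ := hrec (max M₀ M₁) (le_max_left _ _)
  obtain ⟨C, β₀, -, hP⟩ := hPM (max M₀ M₁) (le_max_right _ _)
  have hM2 : 2 ≤ max M₀ M₁ := hM₀.trans (le_max_left _ _)
  have hM1 : 1 ≤ max M₀ M₁ := by linarith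
  have hadm : SoftTubeAdmissible L (powScale (9 / 50)) (recordChi L (9 / 50) 43 (max M₀ M₁)) :=
    softTubeAdmissible_mono (fun β => by have := powScale_pos (9 / 50) β; show powScale (9 / 50) β ≤ 43 * powScale (9 / 50) β; nlinarith)
      (softTubeAdmissible_recordWeightRho L hδ0 (fun β => by
        have : 0 ≤ 43 * powScale (9 / 50) β := (hδ0 β).le
        show 2 * (43 * powScale (9 / 50) β) ≤ max M₀ M₁ * (43 * powScale (9 / 50) β); nlinarith))
  have hco := coreUpper_oneOrbit_of_boBricks
    (boBricks_record hs0 hM1 (A.toRecordBOInput hs0 (by norm_num) (by linarith)) (C := C) (β₀ := β₀) fun β hβ U hU => hP β hβ U hU) hadm hε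
  filter_upwards [hco, Filter.eventually_ge_atTop (0 : ℝ)] with β hβ hβ0
  rw [← hAσ β hβ0]
  exact hβ

/-! ## §3 ★★★ `λ₀ ≤ e^{ελ_b}·recordSigma·μ₀` -/

/-- The endgame: `Λ > 0`, `X ≥ 0`, `0 < λ ≤ 1`, `0 ≤ c ≤ 1/4` and `Λ ≤ max(X + cλΛ, e^{−λ}Λ) + cλΛ` force `Λ ≤ e^{4cλ}·X` (the second branch of the `max` is impossible since
`1 − e^{−λ} ≥ λ/2 > 2cλ`; the first gives `Λ(1 − 2cλ) ≤ X`). [folklore] -/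
theorem arith_lambda0 {Λ X lam c : ℝ} (hΛ : 0 < Λ) (hX : 0 ≤ X) (hlam0 : 0 < lam) (hlam1 : lam ≤ 1) (hc0 : 0 ≤ c) (hc4 : c ≤ 1 / 4)
    (h : Λ ≤ max (X + c * lam * Λ) (Real.exp (-lam) * Λ) + c * lam * Λ) : Λ ≤ Real.exp (4 * c * lam) * X := by
  have hE1 : Real.exp (-lam) * (1 + lam) ≤ 1 := by
    rw [Real.exp_neg, inv_mul_le_iff₀ (Real.exp_pos lam), mul_one]
    have := Real.add_one_le_exp lam
    linarith only [this]
  have hclam : c * lam ≤ lam / 4 := by nlinarith only [hc4, hlam0]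
  rcases le_total (X + c * lam * Λ) (Real.exp (-lam) * Λ) with hle | hle
  · -- impossible branch
    exfalso
    rw [max_eq_right hle] at h
    have h1 : 1 ≤ Real.exp (-lam) + c * lam := by
      by_contra hlt
      push Not at hlt
      nlinarith only [h, hΛ, hlt]
    have hElow : 1 - lam / 4 ≤ Real.exp (-lam) := by linarith only [h1, hclam]
    have h2 : (1 - lam / 4) * (1 + lam) ≤ Real.exp (-lam) * (1 + lam) := mul_le_mul_of_nonneg_right hElow (by linarith only [hlam0])
    nlinarith only [h2, hE1, hlam0, hlam1]
  · rw [max_eq_left hle] at h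
    have h2 : Λ * (1 - 2 * c * lam) ≤ X := by linarith only [h]
    have hy : 2 * c * lam ≤ 1 / 2 := by nlinarith only [hclam, hlam1]
    have hy0 : 0 ≤ 2 * c * lam := by positivity
    have h3 : Λ ≤ Λ * (1 - 2 * c * lam) * (1 + 2 * (2 * c * lam)) := by
      have : 0 ≤ Λ * (2 * c * lam) * (1 - 2 * (2 * c * lam)) := mul_nonneg (mul_nonneg hΛ.le hy0) (by linarith only [hy])
      nlinarith only [this]
    have h4 : Λ * (1 - 2 * c * lam) * (1 + 2 * (2 * c * lam)) ≤ X * (1 + 2 * (2 * c * lam)) := mul_le_mul_of_nonneg_right h2 (by positivity)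
    have h5 : 1 + 2 * (2 * c * lam) ≤ Real.exp (4 * c * lam) := by
      have := Real.add_one_le_exp (4 * c * lam); linarith only [this]
    calc Λ ≤ X * (1 + 2 * (2 * c * lam)) := h3.trans h4
      _ ≤ X * Real.exp (4 * c * lam) := mul_le_mul_of_nonneg_left h5 hX
      _ = Real.exp (4 * c * lam) * X := mul_comm _ _

set_option maxHeartbeats 400000 in
/-- ★★★ **`λ₀(β, L) ≤ e^{ελ_b(L³β)}·recordSigma L β·μ₀(L³β)` eventually in `β`** (`L ≥ 2`, every `ε > 0`): the top zero-flux transfer value of the `L³` lattice is at most the record's slow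
factor times the one-site top value at the natural coupling, up to `e^{o(λ_b)}`.  With ✓`record_floor` this is the two-sided law `λ₀ = e^{o(λ_b)}·recordSigma·μ₀`.
Refined onion + eight copies of the core bound of §2 + the valley gain + the `k = 0` inf–sup door + `arith_lambda0`. [cite: Luscher1983, §3] [cite: SimonB1983DiscreteSpectrum, §3] -/
theorem lambda0_le_record (hL2 : 2 ≤ L) {ε : ℝ} (hε : 0 < ε) :
    ∀ᶠ β : ℝ in atTop, levelValue su2Rep L β 0 ≤
      Real.exp (ε * bareLambda ((L : ℝ) ^ 3 * β)) * (recordSigma L β * levelValue su2Rep 1 ((L : ℝ) ^ 3 * β) 0) := by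
  have hL0 : (0 : ℝ) < L := by exact_mod_cast Nat.pos_of_ne_zero (NeZero.ne L)
  have hL1 : (1 : ℝ) ≤ (L : ℝ) ^ 3 := one_le_pow₀ (by exact_mod_cast NeZero.one_le)
  obtain ⟨hδ, hη, hErr⟩ := scalesAdmissible₂_powScale₉ (L := L) (p := 9 / 50) (q := 17 / 20) (by norm_num) (by norm_num) (by norm_num)
  -- the constant `c = min(ε/16, 1/4)`
  set c : ℝ := min (ε / 16) (1 / 4) with hcdef
  have hc0 : 0 < c := lt_min (by positivity) (by norm_num)
  have hc4 : c ≤ 1 / 4 := min_le_right _ _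
  have hcε : 4 * c ≤ ε / 4 := by have := min_le_left (ε / 16) (1 / 4); linarith only [this]
  obtain ⟨βE, hE⟩ := hErr c hc0
  obtain ⟨βV, hV⟩ := valleyGain_record (L := L) hL2 (a := 9 / 50) (by norm_num) (by norm_num) 1
  have hm0 : (0 : ℝ) < 1 / (2 * L) := by positivity
  obtain ⟨βc, hcross⟩ := crossBound_eventually_small (L := L) hm0 (ε := 4 * c) (by positivity)
  have hδsmall : ∀ᶠ β : ℝ in atTop, powScale (9 / 50) β ≤ 1 / (2 * L) :=
    (tendsto_powScale (σ := 9 / 50) (by norm_num)).eventually (eventually_le_nhds hm0)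
  filter_upwards [coreUpper_record hL2 (half_pos hε), Filter.eventually_ge_atTop (max (max 2 βE) (max βV βc)), hδsmall] with β hcore hβ hδs
  have hβ2 : 2 ≤ β := ((le_max_left _ _).trans (le_max_left _ _)).trans hβ
  have hβE : βE ≤ β := ((le_max_right _ _).trans (le_max_left _ _)).trans hβ
  have hβV : βV ≤ β := ((le_max_left _ _).trans (le_max_right _ _)).trans hβ
  have hβc : βc ≤ β := ((le_max_right _ _).trans (le_max_right _ _)).trans hβ
  have hβ1 : 1 ≤ β := by linarith only [hβ2]
  have hβ0 : 0 < β := by linarith only [hβ2]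
  have hBβ : β ≤ (L : ℝ) ^ 3 * β := by nlinarith only [hL1, hβ0]
  have hB0 : 0 < (L : ℝ) ^ 3 * β := lt_of_lt_of_le hβ0 hBβ
  have hlam0 : 0 < bareLambda ((L : ℝ) ^ 3 * β) := bareLambda_pos' hB0
  have hlam1 : bareLambda ((L : ℝ) ^ 3 * β) ≤ 1 := bareLambda_cube_le (L := L) one_pos (by norm_num; exact hβ2)
  have hμ0 : 0 < levelValue su2Rep 1 ((L : ℝ) ^ 3 * β) 0 := levelValue_su2Rep_pos (L := 1) hB0 0
  have hΛ0 : 0 < levelValue su2Rep L β 0 := levelValue_su2Rep_pos hβ0 0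
  have hσ0 : 0 < recordSigma L β := recordSigma_pos (L := L) hβ0.le
  have hX0 : 0 ≤ Real.exp (ε / 2 * bareLambda ((L : ℝ) ^ 3 * β)) * (recordSigma L β * levelValue su2Rep 1 ((L : ℝ) ^ 3 * β) 0) := by positivity
  -- the error budget through the uniform floor
  have herr : onionErr₂ L β (powScale (9 / 50) β) (powScale (17 / 20) β) * latCE L β ≤ c * bareLambda ((L : ℝ) ^ 3 * β) * levelValue su2Rep L β 0 := by
    have h := mul_le_mul_of_nonneg_right (hE β hβE) (latCE_pos (L := L) hβ0.le).le
    refine h.trans ?_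
    rw [mul_assoc (c * bareLambda ((L : ℝ) ^ 3 * β))]
    exact mul_le_mul_of_nonneg_left (levelValue_zero_ge_uniform hβ1) (by positivity)
  have hcB : 28 * crossBound L β (1 / (2 * L)) ≤ 4 * c * bareLambda ((L : ℝ) ^ 3 * β) * levelValue su2Rep L β 0 :=
    (hcross β hβc).trans (mul_le_mul_of_nonneg_left (levelValue_zero_ge_uniform hβ1) (by positivity))
  -- geometry of the copies
  have hLδ : (L : ℝ) * (powScale (9 / 50) β + 1 / (2 * L)) < 2 := by
    have h1 : (L : ℝ) * (powScale (9 / 50) β + 1 / (2 * L)) ≤ L * (1 / (2 * L) + 1 / (2 * L)) :=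
      mul_le_mul_of_nonneg_left (by linarith only [hδs]) hL0.le
    have e : (L : ℝ) * (1 / (2 * L) + 1 / (2 * L)) = 1 := by field_simp; ring
    linarith only [h1, e]
  have hLδ' : (L : ℝ) * powScale (9 / 50) β < 2 := by nlinarith only [hLδ, hm0, hL0]
  -- abbreviations
  set Λ : ℝ := levelValue su2Rep L β 0 with hΛdef
  set lam : ℝ := bareLambda ((L : ℝ) ^ 3 * β) with hlamdef
  set X : ℝ := Real.exp (ε / 2 * lam) * (recordSigma L β * levelValue su2Rep 1 ((L : ℝ) ^ 3 * β) 0) with hXdef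
  set M : ℝ := max (X + c * lam * Λ) (Real.exp (-lam) * Λ) with hMdef
  have hM1 : X + c * lam * Λ ≤ M := le_max_left _ _
  have hM2 : Real.exp (-lam) * Λ ≤ M := le_max_right _ _
  have hM0 : 0 ≤ M := le_trans (by positivity) hM1
  -- the Rayleigh bound for every physical `ψ`
  have key : ∀ ψ : GaugeConfig 3 L SU2 → ℝ, IsPhys ψ → 0 < l2 ψ ψ → qform su2Rep β ψ ψ ≤ (M + c * lam * Λ) * l2 ψ ψ := by
    intro ψ hψ _
    have honion := qform_le_three_regions_lat₂ hβ0 (hδ β) (hη β) hψ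
    -- the inner piece: eight copies of `G = innerCut·ψ`
    obtain ⟨Cψ, hCψ⟩ := hψ.bounded
    have hGm : Measurable fun V : GaugeConfig 3 L SU2 => innerCut (powScale (9 / 50) β) V * ψ V := measurable_innerCut_mul _ hψ
    have hGb : ∃ C : ℝ, ∀ U, |(fun V : GaugeConfig 3 L SU2 => innerCut (powScale (9 / 50) β) V * ψ V) U| ≤ C :=
      ⟨Cψ, fun U => by
        show |innerCut (powScale (9 / 50) β) U * ψ U| ≤ Cψ
        rw [abs_mul]
        nlinarith only [abs_innerCut_le (powScale (9 / 50) β) U, hCψ U, abs_nonneg (innerCut (powScale (9 / 50) β) U), abs_nonneg (ψ U)]⟩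
    have hGinv : ∀ (g : Site 3 L → SU2) (U : GaugeConfig 3 L SU2),
        (fun V : GaugeConfig 3 L SU2 => innerCut (powScale (9 / 50) β) V * ψ V) (gaugeTransform g U) =
          (fun V : GaugeConfig 3 L SU2 => innerCut (powScale (9 / 50) β) V * ψ V) U := fun g U => by
      show innerCut (powScale (9 / 50) β) (gaugeTransform g U) * ψ (gaugeTransform g U) = innerCut (powScale (9 / 50) β) U * ψ U
      rw [innerCut_gaugeTransform, hψ.gaugeInv]
    have hGsupp : ∀ U, (fun V : GaugeConfig 3 L SU2 => innerCut (powScale (9 / 50) β) V * ψ V) U ≠ 0 → orbitDist U < powScale (9 / 50) β := fun U hU => by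
      by_contra hle
      exact hU (show innerCut (powScale (9 / 50) β) U * ψ U = 0 by rw [innerCut_eq_zero_of_le (hδ β) (not_lt.mp hle), zero_mul])
    have hcoreG := hcore _ hGm hGb hGinv hGsupp
    have hl2G := l2_self_nonneg_lat (fun V : GaugeConfig 3 L SU2 => innerCut (powScale (9 / 50) β) V * ψ V)
    have hin8 := (abs_le.mp (abs_qform_inner_sub_le (L := L) hβ0.le (hδ β) hm0.le hLδ hψ)).2
    have hl2in := l2_inner_eq (hδ β) hLδ' hψ
    have hqin : qform su2Rep β (fun U => Real.cos (innerPhase (powScale (9 / 50) β) U) * ψ U) (fun U => Real.cos (innerPhase (powScale (9 / 50) β) U) * ψ U) ≤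
        (X + c * lam * Λ) * l2 (fun U => Real.cos (innerPhase (powScale (9 / 50) β) U) * ψ U) (fun U => Real.cos (innerPhase (powScale (9 / 50) β) U) * ψ U) := by
      rw [hl2in]
      have h2 : 56 * (crossBound L β (1 / (2 * L)) * l2 (fun V : GaugeConfig 3 L SU2 => innerCut (powScale (9 / 50) β) V * ψ V)
          (fun V : GaugeConfig 3 L SU2 => innerCut (powScale (9 / 50) β) V * ψ V)) ≤
          8 * (c * lam * Λ) * l2 (fun V : GaugeConfig 3 L SU2 => innerCut (powScale (9 / 50) β) V * ψ V)
            (fun V : GaugeConfig 3 L SU2 => innerCut (powScale (9 / 50) β) V * ψ V) := by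
        nlinarith only [hcB, hl2G]
      nlinarith only [hin8, h2, hcoreG, hl2G]
    -- the valley piece
    have hψoutP : IsPhys (fun U => Real.sin (innerPhase (powScale (9 / 50) β) U) * ψ U) := isPhys_outer _ hψ
    have hVal := hV β hβV _ (isPhys_valley (powScale (17 / 20) β) hψoutP) fun U hU => valley_support (hδ β) (hη β) ψ hU
    rw [one_mul] at hVal
    have hvalout := l2_mul_le hψoutP (J := fun U => Real.cos (actionPhase (powScale (17 / 20) β) U)) fun U => Real.abs_cos_le_one _
    have hsplit := l2_cos_add_l2_sin (measurable_innerPhase (powScale (9 / 50) β)) hψ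
    have hl2in0 := l2_self_nonneg_lat (fun U => Real.cos (innerPhase (powScale (9 / 50) β) U) * ψ U)
    have hl2out0 := l2_self_nonneg_lat (fun U => Real.sin (innerPhase (powScale (9 / 50) β) U) * ψ U)
    have hl2val0 := l2_self_nonneg_lat (fun U => Real.cos (actionPhase (powScale (17 / 20) β) U) * (Real.sin (innerPhase (powScale (9 / 50) β) U) * ψ U))
    have hl2ψ0 := l2_self_nonneg_lat ψ
    have heΛ : 0 ≤ Real.exp (-lam) * Λ := by positivity
    calc qform su2Rep β ψ ψ
        ≤ qform su2Rep β (fun U => Real.cos (innerPhase (powScale (9 / 50) β) U) * ψ U) (fun U => Real.cos (innerPhase (powScale (9 / 50) β) U) * ψ U)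
          + qform su2Rep β (fun U => Real.cos (actionPhase (powScale (17 / 20) β) U) * (Real.sin (innerPhase (powScale (9 / 50) β) U) * ψ U))
              (fun U => Real.cos (actionPhase (powScale (17 / 20) β) U) * (Real.sin (innerPhase (powScale (9 / 50) β) U) * ψ U))
          + onionErr₂ L β (powScale (9 / 50) β) (powScale (17 / 20) β) * latCE L β * l2 ψ ψ := honion
      _ ≤ M * l2 (fun U => Real.cos (innerPhase (powScale (9 / 50) β) U) * ψ U) (fun U => Real.cos (innerPhase (powScale (9 / 50) β) U) * ψ U)
          + M * l2 (fun U => Real.sin (innerPhase (powScale (9 / 50) β) U) * ψ U) (fun U => Real.sin (innerPhase (powScale (9 / 50) β) U) * ψ U)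
          + c * lam * Λ * l2 ψ ψ := by
          have h3 := mul_le_mul_of_nonneg_right herr hl2ψ0
          nlinarith only [hqin, hVal, hvalout, hM1, hM2, hl2in0, hl2out0, hl2val0, heΛ, h3, hM0]
      _ = (M + c * lam * Λ) * l2 ψ ψ := by rw [← hsplit]; ring
  -- the door and the endgame
  have hs0 : 0 ≤ M + c * lam * Λ := by positivity
  have hdoor : Λ ≤ M + c * lam * Λ := levelValue_zero_le_of_forall_rayleigh_le su2Rep β hs0 key
  have hfin := arith_lambda0 hΛ0 hX0 hlam0 hlam1 hc0.le hc4 hdoor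
  calc Λ ≤ Real.exp (4 * c * lam) * X := hfin
    _ = Real.exp (4 * c * lam + ε / 2 * lam) * (recordSigma L β * levelValue su2Rep 1 ((L : ℝ) ^ 3 * β) 0) := by
        rw [hXdef, ← mul_assoc, ← Real.exp_add]
    _ ≤ Real.exp (ε * lam) * (recordSigma L β * levelValue su2Rep 1 ((L : ℝ) ^ 3 * β) 0) :=
        mul_le_mul_of_nonneg_right (Real.exp_le_exp.2 (by nlinarith only [hcε, hlam0, hε])) (by positivity)

end Summit.QuantumFields.YangMills.Theorems.FemtoTransferGap.TwoLattice.ConstTube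

end
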